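/-
Copyright: lit-balaban cell, Phase-2 proof seat p11 (gen 5).  Statement-level skeleton of a published paper; no proof claims beyond
what the kernel checks below.
-/
import Literature.MathematicalPhysics.QuantumFieldTheory.BalabanImbrieJaffe1984to88.BIJ85BlockAveragingIneqCov
import Literature.MathematicalPhysics.QuantumFieldTheory.Balaban1983to89.B11V0Interface
import Literature.MathematicalPhysics.QuantumFieldTheory.BalabanImbrieJaffe1984to88.BIJ85HolonomyDeviation

/-!
# `BalabanImbrieJaffe1984to88.BIJ85AbelianStokes` — T. Bałaban, J. Imbrie, A. Jaffe, *Renormalization of the Higgs model: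
minimizers, propagators and the stability of mean field theory*, Commun. Math. Phys. **97** (1985) 299–329
[BalabanImbrieJaffe1985]: the `U(1)` (abelian) STOKES BOOKKEEPING on the torus of record behind Sect. 7.3 p. 326 — the holonomy of a
`U(1)` lattice gauge field around the boundary of a thin rectangle, of a ribbon swept by a straight run, and of an `L × L` square is the
product of the enclosed plaquette variables, hence deviates from `1` by at most (number of plaquettes) × `max_p |u(∂p) − 1|`; and the
plaquette variables of the ITERATED run transports `u^{(i)}` (the fields the `i`-th covariant average (2.6) transports with, gen 3's
`BIJ85BlockAveragesTorusK.lineIter`) deviate from `1` by at most `L^{2i}·max_p |u(∂p) − 1|`.  File 1 of the GENERAL-BACKGROUND member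
of SKELETON row **C1.Eq7.3.1-7.3.2** (seat p11 gen 5; files 2–4: `BIJ85HolonomyDefect`, `BIJ85CovariantPoincare`, `BIJ85Ineq732General`).

statement-level skeleton of published theorems with citation tags; proofs where landed; nothing here is a claim about the Yang–Mills mass gap

PDF held: `paper:balaban1985-cmp97-bij-higgs-minimizers` (journal page = PDF page + 298).  Pages read this session (`lit read`, OCR
text): p. 325–326 [PDF 27–28] (Sect. 7.2–7.3, (7.3.1)–(7.3.2)); pp. 302–303 [PDF 4–5] ((2.4)–(2.10)) as quoted in the gen-3/4 files.

CITATION HEADER (lean-in-tree rule).  Phase-2 file of the lit-balaban TYPED SKELETON (HOME `run/shared/lean/pub/lit-balaban/`), seat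
p11 gen 5 (unit `lit-balaban-p11-g5`; TAKING line HOME/STATUS.md 2026-08-21T10:52:36Z; owner r15, referee ref-5; free-target protocol
G.5-34(d), own lane = the C1 scalar sector §§4.6/7.3 of gens 2–4).  WHAT IS REPRODUCED: the geometric input of SKELETON row
**C1.Eq7.3.1-7.3.2** (`typed p239582`, r15: *"NO printed proof — 'extension of the proofs of [7]' = B4"*) at a GENERAL background — the
mechanism by which the hypothesis **(7.3.1)** *"|v(∂p) − 1| ≤ e_k𝓅(e_k)"* (a bound on PLAQUETTE variables) controls the HOLONOMY DEFECTS
isolated by gen 4 (`BIJ85BlockAveragingIneqCov`, HONEST SCOPE; HOME/GAPS.md G-C1-05 item (i)).  Carriers of record only, BY NAME: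
`Balaban1983to89.Site/PBond/GaugeField P j U1` (`Setup`), the tree's plaquette variable `GaugeField.plaqHol`, `BIJ88Sect3Statements.toC`,
r18's `BIJ85BlockAveragesTorus` (`corner`, `runSite`/`runBond`, `corner_shift`), gen 3's `runProd`/`lineU`/`lineIter`.

THE PRINTED TEXT, verbatim (p. 326 [PDF 28]): *"7.3. Positivity of Δ_k(u_k).  The scalar field quadratic form Δ_k(u_k) depends on the
background field u_k. Hence we can only establish stability properties for Δ_k(u_k) with some restriction on u_k. In particular, let us
assume that for the unit lattice field v, |v(∂p) − 1| ≤ e_k𝓅(e_k), (7.3.1) where 𝓅(e_k) = (1 + ln e_k^{−1})^𝓅. Then the stability estimate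
can be stated in two forms. For constants γ > 0, α > 0, M < ∞, ⟨φ, Δ_k(u_k)φ⟩ ≥ γ Σ_{b∈T₁^{(k)}} |u_k(b)φ(b₊) − φ(b₋)|² − Me_k^{2−α}
Σ_{x∈T₁^{(k)}} |φ(x)|². (7.3.2) … These inequalities can be proved by an extension of the proofs of [7]."*  p. 302 [PDF 4]: *"define
u(Γ) = Π_{b∈Γ} u_b. (2.5)"*; p. 300: *"u(p) = Π_{b∈∂p} u_b"* (the plaquette variable of (1.1)).

WHAT IS PROVED (0 `sorry`, standard axioms).  One definition with a body: `plaqC U x μ ν` = the ORIENTED plaquette variable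
`u(x,x+e_μ)u(x+e_μ,x+e_μ+e_ν)u(x+e_ν,x+e_ν+e_μ)^{−1}u(x,x+e_ν)^{−1} ∈ ℂ` for any ordered pair of directions (= the tree's `plaqHol` read in
`ℂ` for `μ < ν`, its inverse for `ν < μ`, `1` for `μ = ν`: `plaqC_eq_toC_plaqHol`, `plaqC_swap`, `plaqC_self`), so that a bound
`‖u(∂p) − 1‖ ≤ θ` on the tree's plaquettes is a bound on all `plaqC` (`norm_plaqC_sub_one_le_of_plaqHol`).  Then, with `R^μ_n(z) =
toC (runProd u z μ n)` the transport (2.5) along the straight run of `n` bonds: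
* §2 **thin rectangle**: `u⟨z,ν⟩·R^μ_n(z+e_ν)·u⟨z+ne_μ,ν⟩^{−1}·R^μ_n(z)^{−1} = Π_{t<n} plaqC u (z+te_μ) ν μ` (`thinRect_succ`, induction on
  `n`), hence `‖thinRect − 1‖ ≤ nθ` (`norm_thinRect_sub_one_le`).
* §3 **ribbon swept by a straight leg** of `m` bonds in direction `ν` translated by `ne_μ`: `‖legRibbon − 1‖ ≤ m·n·θ`
  (`norm_legRibbon_sub_one_le`; the leg ribbon is the product of the `m` thin rectangles, `legRibbon_succ`).
* §4 **the plaquettes of the run transports**: `‖plaqC (lineU u) y μ ν − 1‖ ≤ L²θ` (an `L × L` square is a leg ribbon with `m = n = L`;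
  `norm_plaqC_lineU_sub_one_le`) and, iterating, **`‖plaqC (lineIter u i) y μ ν − 1‖ ≤ (L²)^i·θ`** for `j + i ≤ m + K`
  (`norm_plaqC_lineIter_sub_one_le`).
Elementary tools (§0–§1): `‖ab − 1‖ ≤ ‖a − 1‖ + ‖b − 1‖` (B11's `B11V0Interface.norm_mul_sub_one_le`, reused, and its `‖b‖ = 1` variant),
`‖a^{−1} − 1‖ = ‖a − 1‖` for `‖a‖ = 1` (p33's `BIJ85HolonomyDeviation.norm_inv_sub_one`, reused); commuting
translations of the torus (`runSite_shift_comm`, `runSite_runSite_comm`), `runProd` over concatenated runs (`toC_runProd_add`), the run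
transport of the run field = the run transport of length `L·s` from the corner (`toC_runProd_lineU`, from r18's `corner_shift`).
HONEST SCOPE.  Pure lattice gauge-field geometry for the abelian group `U(1)`; nothing here involves the background `u_k` of (4.5.4) or the
hypothesis (7.3.1) itself — this file only says how plaquette bounds propagate to loop holonomies and to the iterated transports.
-/

open scoped BigOperators
open Finset

namespace Literature.MathematicalPhysics.QuantumFieldTheory.BalabanImbrieJaffe1984to88.BIJ85AbelianStokes

open Literature.MathematicalPhysics.QuantumFieldTheory.Balaban1983to89
open BIJ88Sect3Statements (U1 toC toC_one toC_mul norm_toC)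
open BIJ85BlockAveragesTorus BIJ85BlockAveragesTorusK BIJ85BlockAveragingIneq
open BIJ85HolonomyDeviation (norm_inv_sub_one)

noncomputable section

variable {P : Params} {j : ℕ}

/-! ## §0 Unit complex numbers: how deviations from `1` add up under products -/

/-- kernel (products (2.5) of unit numbers): `‖ab − 1‖ ≤ ‖a − 1‖ + ‖b − 1‖` when `‖b‖ = 1` (`ab − 1 = (a − 1)b + (b − 1)`); the
`‖a‖ ≤ 1` version is `Balaban1983to89.B11V0Interface.norm_mul_sub_one_le` (used below, not re-proved). [cite: BalabanImbrieJaffe1985, (2.5) p.302] -/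
theorem norm_mul_sub_one_le' {a b : ℂ} (hb : ‖b‖ = 1) : ‖a * b - 1‖ ≤ ‖a - 1‖ + ‖b - 1‖ := by
  rw [mul_comm, add_comm]
  exact B11V0Interface.norm_mul_sub_one_le b a hb.le

/-- kernel: `‖toC (runProd U x μ n)‖ = 1`. [cite: BalabanImbrieJaffe1985, (2.5) p.302] -/
theorem norm_toC_runProd (U : GaugeField P j U1) (x : Balaban1983to89.Site P j) (μ : Fin P.d) (n : ℕ) :
    ‖toC (runProd U x μ n)‖ = 1 := norm_toC _

/-! ## §1 Geometry of the torus: commuting translations; run transports over concatenated runs -/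

/-- kernel: `runSite (x + e_ν) μ t = runSite x μ t + e_ν` — translations of the torus commute (for `ν = μ` both sides are
`x + (t+1)e_μ`). [cite: BalabanImbrieJaffe1985, (2.10) p.303] -/
theorem runSite_shift_comm (x : Balaban1983to89.Site P j) (μ ν : Fin P.d) (t : ℕ) :
    runSite (x.shift ν) μ t = (runSite x μ t).shift ν := by
  funext κ
  by_cases hκμ : κ = μ
  · subst hκμ
    by_cases hκν : κ = ν
    · subst hκν
      simp only [runSite, Balaban1983to89.Site.shift, Function.update_self]
      ring
    · simp only [runSite, Balaban1983to89.Site.shift, Function.update_self, Function.update_of_ne hκν]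
  · by_cases hκν : κ = ν
    · subst hκν
      simp only [runSite, Balaban1983to89.Site.shift, Function.update_self, Function.update_of_ne hκμ]
    · simp only [runSite, Balaban1983to89.Site.shift, Function.update_of_ne hκμ, Function.update_of_ne hκν]

/-- kernel: `runSite (runSite x ν s) μ t = runSite (runSite x μ t) ν s`. [cite: BalabanImbrieJaffe1985, (2.10) p.303] -/
theorem runSite_runSite_comm (x : Balaban1983to89.Site P j) (μ ν : Fin P.d) (t : ℕ) :
    ∀ s : ℕ, runSite (runSite x ν s) μ t = runSite (runSite x μ t) ν s
  | 0 => by rw [runSite_zero, runSite_zero]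
  | s + 1 => by rw [← runSite_shift, ← runSite_shift, runSite_shift_comm, runSite_runSite_comm x μ ν t s]

/-- kernel: one more bond of a run, read in `ℂ`: `R^μ_{n+1}(x) = R^μ_n(x)·u⟨x + ne_μ, μ⟩`. [cite: BalabanImbrieJaffe1985, (2.5) p.302] -/
theorem toC_runProd_succ (U : GaugeField P j U1) (x : Balaban1983to89.Site P j) (μ : Fin P.d) (n : ℕ) :
    toC (runProd U x μ (n + 1)) = toC (runProd U x μ n) * toC (U ⟨runSite x μ n, μ⟩) := by
  rw [runProd, toC_mul]
  rfl

/-- kernel: `R^μ_1(x) = u⟨x, μ⟩`. [cite: BalabanImbrieJaffe1985, (2.5) p.302] -/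
theorem toC_runProd_one (U : GaugeField P j U1) (x : Balaban1983to89.Site P j) (μ : Fin P.d) :
    toC (runProd U x μ 1) = toC (U ⟨x, μ⟩) := by
  rw [toC_runProd_succ, runProd, toC_one, one_mul, runSite_zero]

/-- kernel: (2.5) over concatenated runs, `R^μ_{s+t}(x) = R^μ_s(x)·R^μ_t(x + se_μ)`. [cite: BalabanImbrieJaffe1985, (2.5) p.302] -/
theorem toC_runProd_add (U : GaugeField P j U1) (x : Balaban1983to89.Site P j) (μ : Fin P.d) (s : ℕ) :
    ∀ t : ℕ, toC (runProd U x μ (s + t)) = toC (runProd U x μ s) * toC (runProd U (runSite x μ s) μ t)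
  | 0 => by rw [add_zero, runProd, toC_one, mul_one]
  | t + 1 => by
    rw [← add_assoc, toC_runProd_succ, toC_runProd_add U x μ s t, toC_runProd_succ, runSite_add, mul_assoc]

/-- kernel: the corner of the block `s` steps away: `corner (runSite y μ s) = runSite (corner y) μ (L·s)` (r18's `corner_shift` iterated;
standing range). [cite: BalabanImbrieJaffe1985, (2.10) p.303] -/
theorem corner_runSite (hj : j + 1 ≤ P.m + P.K) (y : Balaban1983to89.Site P (j+1)) (μ : Fin P.d) :
    ∀ s : ℕ, corner (runSite y μ s) = runSite (corner y) μ (P.L * s)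
  | 0 => by rw [runSite_zero, mul_zero, runSite_zero]
  | s + 1 => by rw [← runSite_shift, corner_shift hj, corner_runSite hj y μ s, mul_add, mul_one, runSite_add]

/-- kernel: **the run transport of the run field is the run transport of length `L·s` from the corner**:
`toC (runProd (lineU u) y μ s) = toC (runProd u (corner y) μ (L·s))` (standing range). [cite: BalabanImbrieJaffe1985, (2.5) p.302] -/
theorem toC_runProd_lineU (hj : j + 1 ≤ P.m + P.K) (U : GaugeField P j U1) (y : Balaban1983to89.Site P (j+1)) (μ : Fin P.d) :
    ∀ s : ℕ, toC (runProd (lineU U) y μ s) = toC (runProd U (corner y) μ (P.L * s))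
  | 0 => by rw [mul_zero, runProd, runProd]
  | s + 1 => by
    have e : toC (lineU U ⟨runSite y μ s, μ⟩) = toC (runProd U (corner (runSite y μ s)) μ P.L) := rfl
    rw [toC_runProd_succ, toC_runProd_lineU hj U y μ s, mul_add, mul_one, toC_runProd_add, e, corner_runSite hj]

/-! ## §2 The oriented plaquette variable and the thin rectangle -/

/-- The ORIENTED plaquette variable of a `U(1)` field read in `ℂ`, for any ordered pair of directions `(μ, ν)`:
`u(x,x+e_μ)·u(x+e_μ,x+e_μ+e_ν)·u(x+e_ν,x+e_ν+e_μ)^{−1}·u(x,x+e_ν)^{−1}` — the holonomy (2.5) around `∂p`, `p = ⟨x, x+e_μ, x+e_μ+e_ν, x+e_ν⟩`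
(p. 300 *"u(p) = Π_{b∈∂p} u_b"*; the tree's `GaugeField.plaqHol` is the case `μ < ν`). [cite: BalabanImbrieJaffe1985, (2.5) p.302] -/
def plaqC (U : GaugeField P j U1) (x : Balaban1983to89.Site P j) (μ ν : Fin P.d) : ℂ :=
  toC (U ⟨x, μ⟩) * toC (U ⟨x.shift μ, ν⟩) * (toC (U ⟨x.shift ν, μ⟩))⁻¹ * (toC (U ⟨x, ν⟩))⁻¹

/-- kernel: for `μ < ν`, `plaqC` is the tree's plaquette variable read in `ℂ`. [cite: BalabanImbrieJaffe1985, (2.5) p.302] -/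
theorem plaqC_eq_toC_plaqHol (U : GaugeField P j U1) (x : Balaban1983to89.Site P j) {μ ν : Fin P.d} (h : μ < ν) :
    plaqC U x μ ν = toC (GaugeField.plaqHol U ⟨x, μ, ν, h⟩) := by
  simp only [plaqC, GaugeField.plaqHol, toC_mul, toC_inv']

/-- kernel: reversing the orientation inverts the plaquette variable, `plaqC u x ν μ = (plaqC u x μ ν)^{−1}`. [cite: BalabanImbrieJaffe1985, (2.5) p.302] -/
theorem plaqC_swap (U : GaugeField P j U1) (x : Balaban1983to89.Site P j) (μ ν : Fin P.d) :
    plaqC U x ν μ = (plaqC U x μ ν)⁻¹ := by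
  simp only [plaqC, mul_inv, inv_inv]
  ring

/-- kernel: the degenerate plaquette is trivial, `plaqC u x μ μ = 1`. [cite: BalabanImbrieJaffe1985, (2.5) p.302] -/
theorem plaqC_self (U : GaugeField P j U1) (x : Balaban1983to89.Site P j) (μ : Fin P.d) : plaqC U x μ μ = 1 := by
  simp only [plaqC]
  have h1 := toC_ne_zero (U ⟨x, μ⟩)
  have h2 := toC_ne_zero (U ⟨x.shift μ, μ⟩)
  field_simp

/-- kernel: `‖plaqC u x μ ν‖ = 1`. [cite: BalabanImbrieJaffe1985, (2.5) p.302] -/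
theorem norm_plaqC (U : GaugeField P j U1) (x : Balaban1983to89.Site P j) (μ ν : Fin P.d) : ‖plaqC U x μ ν‖ = 1 := by
  simp only [plaqC, norm_mul, norm_inv, norm_toC, inv_one, mul_one]

/-- **A bound on the tree's plaquette variables is a bound on all oriented ones**: if `‖u(∂p) − 1‖ ≤ θ` for every plaquette `p` of the
torus (the shape of (7.3.1)), then `‖plaqC u x μ ν − 1‖ ≤ θ` for all `x`, `μ`, `ν`. [cite: BalabanImbrieJaffe1985, (7.3.1) p.326] -/
theorem norm_plaqC_sub_one_le_of_plaqHol (U : GaugeField P j U1) {θ : ℝ} (hθ : 0 ≤ θ)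
    (hP : ∀ p : Balaban1983to89.Plaq P j, ‖toC (GaugeField.plaqHol U p) - 1‖ ≤ θ) (x : Balaban1983to89.Site P j) (μ ν : Fin P.d) :
    ‖plaqC U x μ ν - 1‖ ≤ θ := by
  rcases lt_trichotomy μ ν with h | h | h
  · rw [plaqC_eq_toC_plaqHol U x h]
    exact hP ⟨x, μ, ν, h⟩
  · subst h
    rw [plaqC_self, sub_self, norm_zero]
    exact hθ
  · rw [plaqC_swap, norm_inv_sub_one (norm_plaqC U x ν μ), plaqC_eq_toC_plaqHol U x h]
    exact hP ⟨x, ν, μ, h⟩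

/-- The holonomy around the boundary of the THIN RECTANGLE spanned by the bond `⟨z, z+e_ν⟩` and its translate by `ne_μ`:
`z → z+e_ν → z+e_ν+ne_μ → z+ne_μ → z`, i.e. `u⟨z,ν⟩·R^μ_n(z+e_ν)·u⟨z+ne_μ,ν⟩^{−1}·R^μ_n(z)^{−1}` with `R^μ_n` the run transport (2.5).
[cite: BalabanImbrieJaffe1985, (2.5) p.302] -/
def thinRect (U : GaugeField P j U1) (μ : Fin P.d) (n : ℕ) (z : Balaban1983to89.Site P j) (ν : Fin P.d) : ℂ :=
  toC (U ⟨z, ν⟩) * toC (runProd U (z.shift ν) μ n) * (toC (U ⟨runSite z μ n, ν⟩))⁻¹ * (toC (runProd U z μ n))⁻¹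

/-- kernel: the rectangle of length `0` has trivial holonomy. [cite: BalabanImbrieJaffe1985, (2.5) p.302] -/
theorem thinRect_zero (U : GaugeField P j U1) (μ : Fin P.d) (z : Balaban1983to89.Site P j) (ν : Fin P.d) :
    thinRect U μ 0 z ν = 1 := by
  simp only [thinRect, runProd, toC_one, runSite_zero, mul_one, inv_one]
  exact mul_inv_cancel₀ (toC_ne_zero _)

/-- **Abelian Stokes for the thin rectangle** (induction step): extending the rectangle by one bond multiplies its holonomy by the
oriented plaquette variable at the far end, `thinRect (n+1) = thinRect n · plaqC u (z + ne_μ) ν μ` — so the holonomy of the `1 × n`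
rectangle is the product of its `n` plaquette variables. [cite: BalabanImbrieJaffe1985, (2.5) p.302] -/
theorem thinRect_succ (U : GaugeField P j U1) (μ : Fin P.d) (n : ℕ) (z : Balaban1983to89.Site P j) (ν : Fin P.d) :
    thinRect U μ (n + 1) z ν = thinRect U μ n z ν * plaqC U (runSite z μ n) ν μ := by
  simp only [thinRect, plaqC, toC_runProd_succ, runSite_shift_comm, runSite_shift]
  have h1 := toC_ne_zero (U ⟨z, ν⟩)
  have h2 := toC_ne_zero (runProd U (z.shift ν) μ n)
  have h3 := toC_ne_zero (U ⟨(runSite z μ n).shift ν, μ⟩)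
  have h4 := toC_ne_zero (U ⟨runSite z μ (n + 1), ν⟩)
  have h5 := toC_ne_zero (runProd U z μ n)
  have h6 := toC_ne_zero (U ⟨runSite z μ n, μ⟩)
  have h7 := toC_ne_zero (U ⟨runSite z μ n, ν⟩)
  field_simp

/-- kernel: `‖thinRect‖ = 1`. [cite: BalabanImbrieJaffe1985, (2.5) p.302] -/
theorem norm_thinRect (U : GaugeField P j U1) (μ : Fin P.d) (n : ℕ) (z : Balaban1983to89.Site P j) (ν : Fin P.d) :
    ‖thinRect U μ n z ν‖ = 1 := by
  simp only [thinRect, norm_mul, norm_inv, norm_toC, inv_one, mul_one]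

/-- **The thin rectangle deviates from `1` by at most `n·θ`** when every plaquette variable deviates by at most `θ`.
[cite: BalabanImbrieJaffe1985, (7.3.1) p.326] -/
theorem norm_thinRect_sub_one_le (U : GaugeField P j U1) {θ : ℝ}
    (hθ : ∀ (x : Balaban1983to89.Site P j) (μ ν : Fin P.d), ‖plaqC U x μ ν - 1‖ ≤ θ)
    (μ : Fin P.d) (z : Balaban1983to89.Site P j) (ν : Fin P.d) :
    ∀ n : ℕ, ‖thinRect U μ n z ν - 1‖ ≤ n * θ
  | 0 => by rw [thinRect_zero, sub_self, norm_zero, Nat.cast_zero, zero_mul]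
  | n + 1 => by
    rw [thinRect_succ, Nat.cast_succ, add_mul, one_mul]
    exact (B11V0Interface.norm_mul_sub_one_le _ _ (norm_thinRect U μ n z ν).le).trans
      (add_le_add (norm_thinRect_sub_one_le U hθ μ z ν n) (hθ _ _ _))

/-! ## §3 The ribbon swept by a straight leg -/

/-- The holonomy around the RIBBON swept by the straight leg of `m` bonds from `w` in direction `ν` translated by `ne_μ`:
`w → w+ne_μ` (rung `R^μ_n(w)`) `→ w+ne_μ+me_ν` (the translated leg) `→ w+me_ν` (rung back) `→ w` (the leg back).
[cite: BalabanImbrieJaffe1985, (2.5) p.302] -/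
def legRibbon (U : GaugeField P j U1) (μ : Fin P.d) (n : ℕ) (w : Balaban1983to89.Site P j) (ν : Fin P.d) (m : ℕ) : ℂ :=
  (∏ s ∈ range m, toC (U ⟨runSite w ν s, ν⟩))⁻¹ * toC (runProd U w μ n)
    * (∏ s ∈ range m, toC (U ⟨runSite (runSite w ν s) μ n, ν⟩)) * (toC (runProd U (runSite w ν m) μ n))⁻¹

/-- kernel: the ribbon over an empty leg is trivial. [cite: BalabanImbrieJaffe1985, (2.5) p.302] -/
theorem legRibbon_zero (U : GaugeField P j U1) (μ : Fin P.d) (n : ℕ) (w : Balaban1983to89.Site P j) (ν : Fin P.d) :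
    legRibbon U μ n w ν 0 = 1 := by
  simp only [legRibbon, prod_range_zero, inv_one, one_mul, mul_one, runSite_zero]
  exact mul_inv_cancel₀ (toC_ne_zero _)

/-- **Abelian Stokes for the ribbon** (induction step): one more bond of the leg multiplies the ribbon holonomy by (the inverse of) the
thin rectangle standing on that bond, `legRibbon (m+1) = legRibbon m · (thinRect n (w + me_ν) ν)^{−1}`. [cite: BalabanImbrieJaffe1985, (2.5) p.302] -/
theorem legRibbon_succ (U : GaugeField P j U1) (μ : Fin P.d) (n : ℕ) (w : Balaban1983to89.Site P j) (ν : Fin P.d) (m : ℕ) :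
    legRibbon U μ n w ν (m + 1) = legRibbon U μ n w ν m * (thinRect U μ n (runSite w ν m) ν)⁻¹ := by
  simp only [legRibbon, thinRect, prod_range_succ, runSite_shift]
  have h1 : (∏ s ∈ range m, toC (U ⟨runSite w ν s, ν⟩)) ≠ 0 := prod_ne_zero_iff.2 fun _ _ => toC_ne_zero _
  have h2 := toC_ne_zero (U ⟨runSite w ν m, ν⟩)
  have h3 := toC_ne_zero (runProd U w μ n)
  have h4 : (∏ s ∈ range m, toC (U ⟨runSite (runSite w ν s) μ n, ν⟩)) ≠ 0 := prod_ne_zero_iff.2 fun _ _ => toC_ne_zero _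
  have h5 := toC_ne_zero (U ⟨runSite (runSite w ν m) μ n, ν⟩)
  have h6 := toC_ne_zero (runProd U (runSite w ν (m + 1)) μ n)
  have h7 := toC_ne_zero (runProd U (runSite w ν m) μ n)
  field_simp

/-- kernel: `‖legRibbon‖ = 1`. [cite: BalabanImbrieJaffe1985, (2.5) p.302] -/
theorem norm_legRibbon (U : GaugeField P j U1) (μ : Fin P.d) (n : ℕ) (w : Balaban1983to89.Site P j) (ν : Fin P.d) (m : ℕ) :
    ‖legRibbon U μ n w ν m‖ = 1 := by
  simp only [legRibbon, norm_mul, norm_inv, norm_prod, norm_toC, prod_const_one, inv_one, mul_one]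

/-- **The leg ribbon deviates from `1` by at most `m·n·θ`** (`m` thin rectangles of `n` plaquettes each).
[cite: BalabanImbrieJaffe1985, (7.3.1) p.326] -/
theorem norm_legRibbon_sub_one_le (U : GaugeField P j U1) {θ : ℝ}
    (hθ : ∀ (x : Balaban1983to89.Site P j) (μ ν : Fin P.d), ‖plaqC U x μ ν - 1‖ ≤ θ)
    (μ : Fin P.d) (n : ℕ) (w : Balaban1983to89.Site P j) (ν : Fin P.d) :
    ∀ m : ℕ, ‖legRibbon U μ n w ν m - 1‖ ≤ m * n * θ
  | 0 => by rw [legRibbon_zero, sub_self, norm_zero, Nat.cast_zero, zero_mul, zero_mul]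
  | m + 1 => by
    rw [legRibbon_succ, Nat.cast_succ, add_mul, add_mul, one_mul]
    refine (B11V0Interface.norm_mul_sub_one_le _ _ (norm_legRibbon U μ n w ν m).le).trans
      (add_le_add (norm_legRibbon_sub_one_le U hθ μ n w ν m) ?_)
    rw [norm_inv_sub_one (norm_thinRect U μ n _ ν)]
    exact norm_thinRect_sub_one_le U hθ μ _ ν n

/-! ## §4 The plaquette variables of the run transports `lineU u` and of the iterates `u^{(i)} = lineIter u i` -/

/-- kernel: the leg ribbon with `m = n = L` standing at the corner `c` of the block `y` is the inverse of the plaquette variable of the run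
field: `plaqC (lineU u) y μ ν = (legRibbon u ν L c μ L)^{−1}` — the `L × L` square (standing range, r18's `corner_shift`).
[cite: BalabanImbrieJaffe1985, (2.5) p.302] -/
theorem plaqC_lineU_eq (hj : j + 1 ≤ P.m + P.K) (U : GaugeField P j U1) (y : Balaban1983to89.Site P (j+1)) (μ ν : Fin P.d) :
    plaqC (lineU U) y μ ν = (legRibbon U ν P.L (corner y) μ P.L)⁻¹ := by
  have eμ : ∀ z : Balaban1983to89.Site P (j+1), toC (lineU U ⟨z, μ⟩) = toC (runProd U (corner z) μ P.L) := fun z => rfl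
  have eν : ∀ z : Balaban1983to89.Site P (j+1), toC (lineU U ⟨z, ν⟩) = toC (runProd U (corner z) ν P.L) := fun z => rfl
  have eprod : ∀ (w : Balaban1983to89.Site P j),
      (∏ s ∈ range P.L, toC (U ⟨runSite w μ s, μ⟩)) = toC (runProd U w μ P.L) := fun w => by
    rw [toC_runProd]; rfl
  have eprod' : (∏ s ∈ range P.L, toC (U ⟨runSite (runSite (corner y) μ s) ν P.L, μ⟩))
      = toC (runProd U (runSite (corner y) ν P.L) μ P.L) := by
    rw [toC_runProd]
    refine prod_congr rfl fun s _ => ?_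
    rw [runSite_runSite_comm]
    rfl
  rw [plaqC, legRibbon, eμ, eμ, eν, eν, corner_shift hj, corner_shift hj, eprod, eprod']
  have h1 := toC_ne_zero (runProd U (corner y) μ P.L)
  have h2 := toC_ne_zero (runProd U (corner y) ν P.L)
  have h3 := toC_ne_zero (runProd U (runSite (corner y) ν P.L) μ P.L)
  have h4 := toC_ne_zero (runProd U (runSite (corner y) μ P.L) ν P.L)
  field_simp

/-- **The plaquette variables of the run field deviate from `1` by at most `L²θ`** (abelian Stokes for the `L × L` square: the product of
its `L²` plaquette variables; standing range). [cite: BalabanImbrieJaffe1985, (7.3.1) p.326] -/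
theorem norm_plaqC_lineU_sub_one_le (hj : j + 1 ≤ P.m + P.K) (U : GaugeField P j U1) {θ : ℝ}
    (hθ : ∀ (x : Balaban1983to89.Site P j) (μ ν : Fin P.d), ‖plaqC U x μ ν - 1‖ ≤ θ)
    (y : Balaban1983to89.Site P (j+1)) (μ ν : Fin P.d) :
    ‖plaqC (lineU U) y μ ν - 1‖ ≤ (P.L : ℝ) ^ 2 * θ := by
  rw [plaqC_lineU_eq hj, norm_inv_sub_one (norm_legRibbon U ν P.L (corner y) μ P.L), pow_two]
  exact norm_legRibbon_sub_one_le U hθ ν P.L (corner y) μ P.L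

/-- **The plaquette variables of the iterated run fields `u^{(i)} = lineIter u i` deviate from `1` by at most `(L²)^i·θ`** — the fields with
which the `i`-th covariant average (2.6) / the composite contours (5.1.3) transport (`j + i ≤ m + K`). [cite: BalabanImbrieJaffe1985, (7.3.1) p.326] -/
theorem norm_plaqC_lineIter_sub_one_le (U : GaugeField P j U1) {θ : ℝ}
    (hθ : ∀ (x : Balaban1983to89.Site P j) (μ ν : Fin P.d), ‖plaqC U x μ ν - 1‖ ≤ θ) :
    ∀ (i : ℕ), j + i ≤ P.m + P.K → ∀ (y : Balaban1983to89.Site P (j+i)) (μ ν : Fin P.d),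
      ‖plaqC (lineIter U i) y μ ν - 1‖ ≤ ((P.L : ℝ) ^ 2) ^ i * θ
  | 0, _, y, μ, ν => by rw [pow_zero, one_mul]; exact hθ y μ ν
  | i + 1, hi, y, μ, ν => by
    have hi' : j + i + 1 ≤ P.m + P.K := by omega
    rw [lineIter_succ, pow_succ, mul_comm (((P.L : ℝ) ^ 2) ^ i), mul_assoc]
    exact norm_plaqC_lineU_sub_one_le hi' (lineIter U i) (fun x μ' ν' => norm_plaqC_lineIter_sub_one_le U hθ i (by omega) x μ' ν') y μ ν

end

end Literature.MathematicalPhysics.QuantumFieldTheory.BalabanImbrieJaffe1984to88.BIJ85AbelianStokes
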